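import Mathlib.RingTheory.Etale.Weakly
import Mathlib.RingTheory.Flat.EquationalCriterion
import Mathlib.RingTheory.Flat.FaithfullyFlat.Basic
import Mathlib.Algebra.Colimit.DirectLimit
import HarnessLib

/-!
# Directed colimits of flat, faithfully flat and weakly étale algebras

Let `R` be a commutative ring and `(Gᵢ)_{i ∈ ι}` a directed system of commutative `R`-algebras
(`R`-algebra maps `f i j : Gᵢ → Gⱼ` for `i ≤ j` over a directed preorder `ι`), with colimit
`B = colim Gᵢ` (Mathlib's `DirectLimit G f`, an `R`-algebra). We prove:

* `flat_directLimit` — if every `Gᵢ` is `R`-flat, so is `B` ("flatness is preserved under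
  filtered colimits", Bhatt–Scholze Lemma 4.1.8 (proof); Stacks 05UU);
* `faithfullyFlat_directLimit` — if every `Gᵢ` is faithfully flat over `R`, so is `B`
  (Bhatt–Scholze Example 3.1.7: "`B = colim_n B_n` is a faithfully flat `A`-algebra");
* `weaklyEtale_directLimit` — if every `Gᵢ` is weakly étale over `R` (`R → Gᵢ` and
  `Gᵢ ⊗_R Gᵢ → Gᵢ` flat), so is `B` (Bhatt–Scholze Lemma 4.1.8: "the limit of a cofiltered diagram
  of affine weakly étale `X`-schemes is … weakly étale over `X`"; Stacks 092N).

All three are proved with Lazard's equational criterion (Mathlib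
`Module.Flat.iff_forall_isTrivialRelation`): a finite relation in the colimit descends to some
stage `Gⱼ`, is trivial there by flatness, and the trivialisation is pushed back to the colimit;
for `B ⊗_R B → B` the coefficients live in `B ⊗_R B` and descend to some `Gⱼ ⊗_R Gⱼ`.

## References

* B. Bhatt, P. Scholze, *The pro-étale topology for schemes*, Astérisque 369 (2015)
  (arXiv:1309.1198), Example 3.1.7, Lemma 4.1.8 (with proof), Prop. 2.3.3. [BhattScholze2015]

## Design notes

* Stated for Mathlib's `_root_.DirectLimit` of a `DirectedSystem` of `AlgHom`s (explicit
  equality criterion `DirectLimit.exists_eq_zero`), over an arbitrary nonempty directed preorder.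
* Mathlib searches: `Module.Flat.directSum` (direct sums only), `Algebra.WeaklyEtale` (base
  change, composition, no colimits), `Module.FaithfullyFlat.trans`; no flatness statement for
  direct limits / filtered colimits. Nothing restated.
-/

universe u v w

namespace Literature.RingTheory.Etale

open TensorProduct

variable {R : Type u} [CommRing R] {ι : Type w} [Preorder ι] [Nonempty ι] [IsDirectedOrder ι]
  {G : ι → Type v} [∀ i, CommRing (G i)] [∀ i, Algebra R (G i)]
  (f : ∀ i j, i ≤ j → G i →ₐ[R] G j) [DirectedSystem G (f · · ·)]

/-! ### Finite families of elements of a direct limit come from a common stage -/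

/-- Finitely many elements of `colim Gᵢ` are images of elements of a single `Gᵢ`. [folklore] -/
theorem exists_of_eq_family {κ : Type*} [Finite κ] (x : κ → DirectLimit G f) :
    ∃ (i : ι) (y : κ → G i), ∀ k, DirectLimit.Algebra.of G f i (y k) = x k := by
  classical
  have hx : ∀ k, ∃ (i : ι) (y : G i), x k = ⟦⟨i, y⟩⟧ := fun k => DirectLimit.exists_eq_mk _ (x k)
  choose i y hy using hx
  haveI := Fintype.ofFinite κ
  obtain ⟨j, hj⟩ := Finset.exists_le (Finset.univ.image i)
  refine ⟨j, fun k => f (i k) j (hj _ (Finset.mem_image_of_mem i (Finset.mem_univ k))) (y k),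
    fun k => ?_⟩
  rw [DirectLimit.Algebra.of_f, DirectLimit.Algebra.of_apply, hy k]

/-! ### Flatness -/

/-- **A directed colimit of flat algebras is flat** (Lazard's equational criterion: a finite
relation `∑ rₖ xₖ = 0` in `colim Gᵢ` already holds in some `Gⱼ`, is trivial there, and the
trivialisation maps to the colimit). Bhatt–Scholze Lemma 4.1.8 (proof): "flatness is preserved
under filtered colimits of rings". [cite: BhattScholze2015, Lemma 4.1.8 (proof)] -/
theorem flat_directLimit [∀ i, Module.Flat R (G i)] : Module.Flat R (DirectLimit G f) := by
  classical
  rw [Module.Flat.iff_forall_isTrivialRelation]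
  intro l r x hx
  obtain ⟨i, y, hy⟩ := exists_of_eq_family f x
  have h0 : DirectLimit.Algebra.of G f i (∑ k, r k • y k) = 0 := by
    simp only [map_sum, map_smul, hy, hx]
  rw [DirectLimit.Algebra.of_apply] at h0
  obtain ⟨j, hij, hj⟩ := (DirectLimit.exists_eq_zero _).1 h0
  change i ≤ j at hij
  change f i j hij (∑ k, r k • y k) = 0 at hj
  simp only [map_sum, map_smul] at hj
  obtain ⟨m, a, z, hz, ha⟩ := Module.Flat.isTrivialRelation_of_sum_smul_eq_zero hj
  refine ⟨m, a, fun t => DirectLimit.Algebra.of G f j (z t), fun k => ?_, ha⟩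
  have hzk : f i j hij (y k) = ∑ t, a k t • z t := hz k
  rw [← hy k, ← DirectLimit.Algebra.of_f hij, hzk, map_sum]
  simp only [map_smul]

/-! ### Faithful flatness -/

/-- Elements of the extension `I·colim Gᵢ` of an ideal `I ⊆ R` come from `I·Gⱼ` for some `j`.
[folklore] -/
theorem exists_of_eq_of_mem_map (I : Ideal R) {b : DirectLimit G f}
    (hb : b ∈ I.map (algebraMap R (DirectLimit G f))) :
    ∃ (j : ι) (y : G j), y ∈ I.map (algebraMap R (G j)) ∧ DirectLimit.Algebra.of G f j y = b := by
  refine Submodule.span_induction ?_ ?_ ?_ ?_ hb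
  · rintro _ ⟨r, hr, rfl⟩
    refine ⟨Classical.arbitrary ι, algebraMap R _ r, Ideal.mem_map_of_mem _ hr, ?_⟩
    exact AlgHom.commutes _ r
  · exact ⟨Classical.arbitrary ι, 0, Ideal.zero_mem _, map_zero _⟩
  · rintro b b' - - ⟨j, y, hy, rfl⟩ ⟨j', y', hy', rfl⟩
    obtain ⟨k, hjk, hj'k⟩ := exists_ge_ge j j'
    refine ⟨k, f j k hjk y + f j' k hj'k y', Ideal.add_mem _ ?_ ?_, ?_⟩
    · simpa only [Ideal.map_map, AlgHom.comp_algebraMap, RingHom.coe_coe] using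
        Ideal.mem_map_of_mem (f j k hjk : G j →+* G k) hy
    · simpa only [Ideal.map_map, AlgHom.comp_algebraMap, RingHom.coe_coe] using
        Ideal.mem_map_of_mem (f j' k hj'k : G j' →+* G k) hy'
    · rw [map_add, DirectLimit.Algebra.of_f, DirectLimit.Algebra.of_f]
  · rintro c b - ⟨j, y, hy, rfl⟩
    obtain ⟨i, c', rfl⟩ := DirectLimit.exists_eq_mk _ c
    obtain ⟨k, hik, hjk⟩ := exists_ge_ge i j
    refine ⟨k, f i k hik c' * f j k hjk y, Ideal.mul_mem_left _ _ ?_, ?_⟩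
    · simpa only [Ideal.map_map, AlgHom.comp_algebraMap, RingHom.coe_coe] using
        Ideal.mem_map_of_mem (f j k hjk : G j →+* G k) hy
    · rw [smul_eq_mul, map_mul, DirectLimit.Algebra.of_f, DirectLimit.Algebra.of_f,
        DirectLimit.Algebra.of_apply]

/-- **A directed colimit of faithfully flat algebras is faithfully flat**: if `I·B = B` for
`B = colim Gᵢ` then `1 ∈ I·B` comes from some `I·Gⱼ`, becomes `1` in some `Gₖ`, so
`I·Gₖ = Gₖ` and `I = R` by faithful flatness of `Gₖ`. Bhatt–Scholze Example 3.1.7: "`B = colim_n B_n`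
is a faithfully flat `A`-algebra". [cite: BhattScholze2015, Example 3.1.7] -/
theorem faithfullyFlat_directLimit [∀ i, Module.FaithfullyFlat R (G i)] :
    Module.FaithfullyFlat R (DirectLimit G f) := by
  rw [Module.FaithfullyFlat.iff_flat_and_ideal_smul_eq_top]
  refine ⟨flat_directLimit f, fun I hI => ?_⟩
  rw [Ideal.smul_top_eq_map, Submodule.restrictScalars_eq_top_iff] at hI
  have h1 : (1 : DirectLimit G f) ∈ I.map (algebraMap R (DirectLimit G f)) := by
    rw [hI]; trivial
  obtain ⟨j, y, hy, hy1⟩ := exists_of_eq_of_mem_map f I h1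
  have h0 : DirectLimit.Algebra.of G f j (y - 1) = 0 := by rw [map_sub, hy1, map_one, sub_self]
  rw [DirectLimit.Algebra.of_apply] at h0
  obtain ⟨k, hjk, hk⟩ := (DirectLimit.exists_eq_zero _).1 h0
  change j ≤ k at hjk
  change f j k hjk (y - 1) = 0 at hk
  rw [map_sub, map_one, sub_eq_zero] at hk
  have hyk : f j k hjk y ∈ I.map (algebraMap R (G k)) := by
    simpa only [Ideal.map_map, AlgHom.comp_algebraMap, RingHom.coe_coe] using
      Ideal.mem_map_of_mem (f j k hjk : G j →+* G k) hy
  rw [hk] at hyk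
  have htop : I • (⊤ : Submodule R (G k)) = ⊤ := by
    rw [Ideal.smul_top_eq_map, Submodule.restrictScalars_eq_top_iff]
    exact (Ideal.eq_top_iff_one _).2 hyk
  exact ((Module.FaithfullyFlat.iff_flat_and_ideal_smul_eq_top R (G k)).1 inferInstance).2 I htop

/-! ### Weak étaleness -/

section WeaklyEtale

/-- The maps `Gᵢ ⊗_R Gᵢ → B ⊗_R B`, `B = colim Gᵢ`. [folklore] -/
noncomputable abbrev tensorToLimit (i : ι) :
    G i ⊗[R] G i →ₐ[R] DirectLimit G f ⊗[R] DirectLimit G f :=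
  Algebra.TensorProduct.map (DirectLimit.Algebra.of G f i) (DirectLimit.Algebra.of G f i)

omit [Nonempty ι] [IsDirectedOrder ι] [DirectedSystem G (f · · ·)] in
/-- The transition maps `Gᵢ ⊗_R Gᵢ → Gⱼ ⊗_R Gⱼ`. [folklore] -/
noncomputable abbrev tensorTransition (i j : ι) (h : i ≤ j) : G i ⊗[R] G i →ₐ[R] G j ⊗[R] G j :=
  Algebra.TensorProduct.map (f i j h) (f i j h)

/-- Compatibility of the structure maps `Gᵢ → colim Gᵢ` with the transition maps. [folklore] -/
theorem of_comp_f (i j : ι) (h : i ≤ j) :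
    (DirectLimit.Algebra.of G f j).comp (f i j h) = DirectLimit.Algebra.of G f i :=
  AlgHom.ext fun x => DirectLimit.Algebra.of_f h x

/-- Compatibility of `Gᵢ ⊗ Gᵢ → B ⊗ B` with the transition maps. [folklore] -/
theorem tensorToLimit_comp_tensorTransition (i j : ι) (h : i ≤ j) :
    (tensorToLimit f j).comp (tensorTransition f i j h) = tensorToLimit f i := by
  rw [tensorToLimit, tensorTransition, ← Algebra.TensorProduct.map_comp, of_comp_f]

/-- Compatibility of `Gᵢ ⊗ Gᵢ → B ⊗ B` with the transition maps, on elements. [folklore] -/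
theorem tensorToLimit_tensorTransition (i j : ι) (h : i ≤ j) (t : G i ⊗[R] G i) :
    tensorToLimit f j (tensorTransition f i j h t) = tensorToLimit f i t :=
  congr($(tensorToLimit_comp_tensorTransition f i j h) t)

/-- Every element of `B ⊗_R B` comes from some `Gᵢ ⊗_R Gᵢ`. [folklore] -/
theorem exists_tensorToLimit_eq (c : DirectLimit G f ⊗[R] DirectLimit G f) :
    ∃ (i : ι) (t : G i ⊗[R] G i), tensorToLimit f i t = c := by
  induction c using TensorProduct.induction_on with
  | zero => exact ⟨Classical.arbitrary ι, 0, map_zero _⟩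
  | tmul b b' =>
    obtain ⟨i, x, rfl⟩ := DirectLimit.exists_eq_mk _ b
    obtain ⟨i', x', rfl⟩ := DirectLimit.exists_eq_mk _ b'
    obtain ⟨k, hik, hi'k⟩ := exists_ge_ge i i'
    refine ⟨k, f i k hik x ⊗ₜ f i' k hi'k x', ?_⟩
    rw [Algebra.TensorProduct.map_tmul, DirectLimit.Algebra.of_f, DirectLimit.Algebra.of_f,
      DirectLimit.Algebra.of_apply, DirectLimit.Algebra.of_apply]
  | add c c' hc hc' =>
    obtain ⟨i, t, rfl⟩ := hc
    obtain ⟨i', t', rfl⟩ := hc'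
    obtain ⟨k, hik, hi'k⟩ := exists_ge_ge i i'
    refine ⟨k, tensorTransition f i k hik t + tensorTransition f i' k hi'k t', ?_⟩
    rw [map_add, tensorToLimit_tensorTransition, tensorToLimit_tensorTransition]

/-- Finitely many elements of `B ⊗_R B` come from a common `Gᵢ ⊗_R Gᵢ`. [folklore] -/
theorem exists_tensorToLimit_eq_family {κ : Type*} [Finite κ]
    (c : κ → DirectLimit G f ⊗[R] DirectLimit G f) :
    ∃ (i : ι) (t : κ → G i ⊗[R] G i), ∀ k, tensorToLimit f i (t k) = c k := by
  classical
  choose i t ht using fun k => exists_tensorToLimit_eq f (c k)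
  haveI := Fintype.ofFinite κ
  obtain ⟨j, hj⟩ := Finset.exists_le (Finset.univ.image i)
  refine ⟨j, fun k => tensorTransition f (i k) j
    (hj _ (Finset.mem_image_of_mem i (Finset.mem_univ k))) (t k), fun k => ?_⟩
  rw [tensorToLimit_tensorTransition, ht]

/-- `mult_B ∘ (Gᵢ ⊗ Gᵢ → B ⊗ B) = (Gᵢ → B) ∘ mult_{Gᵢ}`. [folklore] -/
theorem lmul'_tensorToLimit (i : ι) (t : G i ⊗[R] G i) :
    Algebra.TensorProduct.lmul' R (tensorToLimit f i t) =
      DirectLimit.Algebra.of G f i (Algebra.TensorProduct.lmul' R (S := G i) t) := by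
  induction t using TensorProduct.induction_on with
  | zero => simp only [map_zero]
  | tmul x y => simp only [Algebra.TensorProduct.map_tmul, Algebra.TensorProduct.lmul'_apply_tmul,
      map_mul]
  | add t t' ht ht' => simp only [map_add, ht, ht']

omit [Nonempty ι] [IsDirectedOrder ι] [DirectedSystem G (f · · ·)] in
/-- `mult_{Gⱼ} ∘ (Gᵢ ⊗ Gᵢ → Gⱼ ⊗ Gⱼ) = f i j ∘ mult_{Gᵢ}`. [folklore] -/
theorem lmul'_tensorTransition (i j : ι) (h : i ≤ j) (t : G i ⊗[R] G i) :
    Algebra.TensorProduct.lmul' R (tensorTransition f i j h t) =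
      f i j h (Algebra.TensorProduct.lmul' R (S := G i) t) := by
  induction t using TensorProduct.induction_on with
  | zero => simp only [map_zero]
  | tmul x y => simp only [Algebra.TensorProduct.map_tmul, Algebra.TensorProduct.lmul'_apply_tmul,
      map_mul]
  | add t t' ht ht' => simp only [map_add, ht, ht']

/-- **The multiplication `B ⊗_R B → B` of a directed colimit `B = colim Gᵢ` of weakly étale
`R`-algebras is flat**: a finite relation `∑ cₖ xₖ = 0` (`cₖ ∈ B ⊗ B`, `xₖ ∈ B`) descends to
some `Gⱼ ⊗ Gⱼ`, `Gⱼ`, is trivial there because `Gⱼ ⊗ Gⱼ → Gⱼ` is flat, and the trivialisation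
maps back. [cite: BhattScholze2015, Lemma 4.1.8 (proof)] -/
theorem flat_lmul'_directLimit [∀ i, Algebra.WeaklyEtale R (G i)] :
    (Algebra.TensorProduct.lmul' R (S := DirectLimit G f)).Flat := by
  classical
  letI alg : Algebra (DirectLimit G f ⊗[R] DirectLimit G f) (DirectLimit G f) :=
    (Algebra.TensorProduct.lmul' R (S := DirectLimit G f)).toRingHom.toAlgebra
  change Module.Flat (DirectLimit G f ⊗[R] DirectLimit G f) (DirectLimit G f)
  rw [Module.Flat.iff_forall_isTrivialRelation]
  intro l c x hx
  -- descend the coefficients and the elements to a common stage `j`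
  obtain ⟨i, c', hc'⟩ := exists_tensorToLimit_eq_family f c
  obtain ⟨i', x', hx'⟩ := exists_of_eq_family f x
  obtain ⟨j, hij, hi'j⟩ := exists_ge_ge i i'
  set c₁ : Fin l → G j ⊗[R] G j := fun k => tensorTransition f i j hij (c' k) with hc₁def
  set x₁ : Fin l → G j := fun k => f i' j hi'j (x' k) with hx₁def
  have hc₁ : ∀ k, tensorToLimit f j (c₁ k) = c k := fun k => by
    rw [hc₁def, tensorToLimit_tensorTransition, hc']
  have hx₁ : ∀ k, DirectLimit.Algebra.of G f j (x₁ k) = x k := fun k => by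
    rw [hx₁def, DirectLimit.Algebra.of_f, hx']
  -- the relation at stage `j` dies in `B` ...
  have h0 : DirectLimit.Algebra.of G f j (∑ k, Algebra.TensorProduct.lmul' R (c₁ k) * x₁ k) = 0 := by
    rw [map_sum, ← hx]
    refine Finset.sum_congr rfl fun k _ => ?_
    rw [map_mul, ← lmul'_tensorToLimit, hc₁, hx₁, Algebra.smul_def, RingHom.algebraMap_toAlgebra]
    rfl
  rw [DirectLimit.Algebra.of_apply] at h0
  -- ... hence at some stage `j'`
  obtain ⟨j', hjj', hj'⟩ := (DirectLimit.exists_eq_zero _).1 h0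
  change j ≤ j' at hjj'
  change f j j' hjj' (∑ k, Algebra.TensorProduct.lmul' R (c₁ k) * x₁ k) = 0 at hj'
  have hrel : ∑ k, Algebra.TensorProduct.lmul' R (tensorTransition f j j' hjj' (c₁ k)) *
      f j j' hjj' (x₁ k) = 0 := by
    rw [map_sum] at hj'
    simpa only [map_mul, lmul'_tensorTransition] using hj'
  -- flatness of `Gⱼ' ⊗ Gⱼ' → Gⱼ'`
  letI alg' : Algebra (G j' ⊗[R] G j') (G j') :=
    (Algebra.TensorProduct.lmul' R (S := G j')).toRingHom.toAlgebra
  haveI : Module.Flat (G j' ⊗[R] G j') (G j') := Algebra.WeaklyEtale.flat_lmul' R (G j')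
  have hrel' : ∑ k, tensorTransition f j j' hjj' (c₁ k) • f j j' hjj' (x₁ k) = 0 := by
    simpa only [Algebra.smul_def, RingHom.algebraMap_toAlgebra, AlgHom.toRingHom_eq_coe,
      RingHom.coe_coe] using hrel
  obtain ⟨m, a, z, hz, ha⟩ := Module.Flat.isTrivialRelation_of_sum_smul_eq_zero hrel'
  refine ⟨m, fun k t => tensorToLimit f j' (a k t), fun t => DirectLimit.Algebra.of G f j' (z t),
    fun k => ?_, fun t => ?_⟩
  · have hzk : f j j' hjj' (x₁ k) = ∑ t, a k t • z t := hz k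
    rw [← hx₁ k, ← DirectLimit.Algebra.of_f hjj', hzk, map_sum]
    refine Finset.sum_congr rfl fun t _ => ?_
    rw [Algebra.smul_def, Algebra.smul_def, RingHom.algebraMap_toAlgebra,
      RingHom.algebraMap_toAlgebra, map_mul, AlgHom.toRingHom_eq_coe, AlgHom.toRingHom_eq_coe,
      RingHom.coe_coe, RingHom.coe_coe, lmul'_tensorToLimit]
  · have hck : ∀ k, c k = tensorToLimit f j' (tensorTransition f j j' hjj' (c₁ k)) := fun k => by
      rw [tensorToLimit_tensorTransition, hc₁]
    simp only [hck, ← map_mul, ← map_sum, ha t, map_zero]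

/-- **A directed colimit of weakly étale algebras is weakly étale** (`R → colim Gᵢ` flat and
`colim Gᵢ ⊗_R colim Gᵢ → colim Gᵢ` flat). Bhatt–Scholze Lemma 4.1.8: "the limit of a cofiltered
diagram of affine weakly étale `X`-schemes is an affine `X`-scheme that is weakly étale over `X`";
Stacks 092N. [cite: BhattScholze2015, Lemma 4.1.8] -/
theorem weaklyEtale_directLimit [∀ i, Algebra.WeaklyEtale R (G i)] :
    Algebra.WeaklyEtale R (DirectLimit G f) where
  flat := flat_directLimit f
  flat_lmul' := flat_lmul'_directLimit f

end WeaklyEtale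

end Literature.RingTheory.Etale
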